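import Summits.QuantumFields.YangMills.Theorems.SwapVirialDeficitZeroModeGroupThreeLaplaceRateHub
import HarnessLib

/-!
# Exact zero-mode rung on the GROUP, three letters, Laplace form — X: THE POWER RATE `|β²Λ₃(β) − v₃| ≤ K·β^{−1/48}`
# (free-hands support of ⟨stmt-QuantumFields-24197⟩; quantifies w2 g55's ✓`tendsto_sq_mul_laplaceThree`)

`Λ₃(β) = ∫_{SU(2)³} e^{−β(‖[q₀,q₁]‖² + ‖[q₀,q₂]‖² + ‖[q₁,q₂]‖²)} dHaar³` (✓`laplaceThree`).  Parts I–V (w2 g55) proved `β²Λ₃(β) → v₃ > 0`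
by dominated convergence; parts VI–IX (this seat) quantified every step: at a good hub `a`, `∫∫h_s ≤ ∫∫h_0 + s^{1/48}E(a)` and
`∫∫h_0 ≤ ∫∫h_s + s^{1/48}E(a)` with `∫E dcone < ∞` (✓`lintegral_hsc_le_add`, ✓`lintegral_hsc_zero_le_add`, ✓`lintegral_cone_rateE_lt_top`).
Here the hub integral is taken:
* §1 `laplaceThreeLimit = (coneConst²·∫dcone(a)∫∫h_0)` — THE constant `v₃` as a definition, and the two one-sided integral bounds;
* §2 ★★★ `abs_sq_mul_laplaceThree_sub_limit_le` — `|β²Λ₃(β) − v₃| ≤ K·β^{−1/48}` for `β ≥ 1`, `K = (coneConst²·∫E dcone).toReal`;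
  ★★ `tendsto_sq_mul_laplaceThree_limit` (so `v₃` IS the limit of ✓`tendsto_sq_mul_laplaceThree`), ★★ `laplaceThreeLimit_pos`;
* §3 ★★★ `laplaceThree_sharp` — the headline `∃ v K θ, 0 < v ∧ 0 < θ ∧ ∀ β ≥ 1, |β²Λ₃(β) − v| ≤ K·β^{−θ}` (θ = 1/48, not optimised;
  the true rate is `β^{−1/2}` up to logarithms — the region where a letter is `β^{−1/2}`-close to `±1` and the curvature of the tangent cones).
This is the sharp-with-power-remainder shape a Laplace-type sharp law with power remainder consumes (the currency of
✓`SharpSigma.swapGluedStiffness_of_sharpSwapLaplace`), for the `k = 3` zero-mode block.  HONEST LABEL: finite-dimensional real analysis (plan-level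
zero-mode rung of a DRAFT line «sharp-sigma»); NOT the fixed-`L` sharp law, NOT ⟨24197⟩; the Yang–Mills mass gap is NOT proved; no summit is proved by
a line.  Width seat ym-line-sfw-p2-w2 g56 (cell ym-idea-1, free hands; own crux ⟨22884⟩ blocked-on ⟨19935⟩), `--supports stmt-QuantumFields-24197`.
Standard axioms, 0 `sorry`.  References: [cite: GonzalezarroyoAltes1988]; [cite: Vanbaal2001]; [folklore].
-/

set_option autoImplicit false

noncomputable section

open MeasureTheory Quaternion Set Filter Topology
open scoped Quaternion ENNReal
open Literature.MathematicalPhysics.QuantumLattice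
open Summit.QuantumFields.YangMills.Theorems.SwapTwistDeficit.ToronLog

attribute [local instance] Literature.Analysis.FluidPDE.Tao2016.quatMeasurableSpace
  Literature.Analysis.FluidPDE.Tao2016.quatBorelSpace
  Literature.MathematicalPhysics.QuantumLattice.secondCountableTopology_su2

namespace Summit.QuantumFields.YangMills.Theorems.SwapVirialDeficit.ZeroModeGroup

/-! ## §1 The constant `v₃` and the two one-sided integral bounds -/

/-- The inner pair integral at scale `s` and hub `a`: `K_s(a) = ∫∫ h_s(x,y) dxdy` at `(A, r) = (‖a‖², ‖Im a‖)` (axis hub). [folklore] -/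
def innerK (s : ℝ) (a : ℍ) : ℝ≥0∞ := ∫⁻ z, hsc s (‖axisPoint a‖ ^ 2) (axisPoint a).imI z.1 z.2 ∂((volume : Measure ℍ).prod volume)

/-- ★ **THE constant `v₃`** (as `ℝ≥0∞`): `coneConst²·∫dcone(a) ∫∫ h_0`. [cite: GonzalezarroyoAltes1988] [cite: Vanbaal2001] -/
def laplaceThreeLimENN : ℝ≥0∞ := ∫⁻ a, ENNReal.ofReal coneConst * (ENNReal.ofReal coneConst * innerK 0 a) ∂coneMeasure

/-- ★ **THE constant `v₃ = lim β²Λ₃(β)`** as a real number. [cite: GonzalezarroyoAltes1988] [cite: Vanbaal2001] -/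
def laplaceThreeLimit : ℝ := laplaceThreeLimENN.toReal

/-- The error mass `M = coneConst²·∫ E dcone` (finite). [folklore] -/
def rateM : ℝ≥0∞ := ENNReal.ofReal coneConst * (ENNReal.ofReal coneConst * ∫⁻ a, rateE a ∂coneMeasure)

/-- `M < ∞`. [folklore] -/
theorem rateM_lt_top : rateM < ∞ :=
  ENNReal.mul_lt_top ENNReal.ofReal_lt_top (ENNReal.mul_lt_top ENNReal.ofReal_lt_top lintegral_cone_rateE_lt_top)

/-- Good hubs are almost all hubs. [folklore] -/
theorem ae_goodHub : ∀ᵐ a ∂coneMeasure, a ∈ Metric.ball (0:ℍ) 1 ∧ a.imJ ≠ 0 ∧ coneQ a ≠ 0 := by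
  have h1 : ∀ᵐ a ∂coneMeasure, a ∈ Metric.ball (0:ℍ) 1 := by
    unfold coneMeasure; exact Measure.ae_smul_measure (ae_restrict_mem measurableSet_ball) _
  filter_upwards [h1, ae_cone_imJ_ne_zero, ae_coneQ_ne_zero] with a ha hb hq using ⟨ha, hb, hq⟩

/-- `β²Λ₃(β)` as the hub integral of `coneConst²·K_{β⁻¹}` (`β > 0`). [folklore] -/
theorem ofReal_sq_mul_laplaceThree_eq {β : ℝ} (hβ : 0 < β) :
    ENNReal.ofReal (β ^ 2 * laplaceThree β) = ∫⁻ a, ENNReal.ofReal coneConst * (ENNReal.ofReal coneConst * innerK β⁻¹ a) ∂coneMeasure := by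
  have hint : ∫⁻ a, ENNReal.ofReal (β ^ 2) * psiCone β a ∂coneMeasure = ENNReal.ofReal (β ^ 2 * laplaceThree β) := by
    rw [lintegral_const_mul _ (measurable_psiCone β), ← ofReal_laplaceThree_eq_lintegral_psiCone hβ.le, ← ENNReal.ofReal_mul (sq_nonneg β)]
  rw [← hint]
  refine lintegral_congr_ae ?_
  filter_upwards [ae_goodHub] with a ha
  unfold innerK
  rw [psiCone_eq_axis β ha.2.2, sq_mul_psiCone_eq_lintegral_hsc hβ (axisPoint a) (axisPoint_components a).2.2.1
    (axisPoint_components a).2.2.2, lintegral_lintegral_hsc_eq]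

/-- `a ↦ β²ψ_β` form of the integrand is measurable (used to split integrals). [folklore] -/
theorem measurable_sqPsi (β : ℝ) : Measurable fun a : ℍ => ENNReal.ofReal (β ^ 2) * psiCone β a := (measurable_psiCone β).const_mul _

/-- ★★ **UPPER INTEGRAL BOUND**: `β²Λ₃(β) ≤ v₃ + β^{−1/48}·M` for `β ≥ 1` (in `ℝ≥0∞`). [folklore] -/
theorem ofReal_sq_mul_laplaceThree_le {β : ℝ} (hβ : 1 ≤ β) :
    ENNReal.ofReal (β ^ 2 * laplaceThree β) ≤ laplaceThreeLimENN + ENNReal.ofReal (β⁻¹ ^ (1/48 : ℝ)) * rateM := by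
  have hβ0 : 0 < β := by linarith
  have hs0 : 0 < β⁻¹ := inv_pos.2 hβ0
  have hs1 : β⁻¹ ≤ 1 := inv_le_one_of_one_le₀ hβ
  rw [ofReal_sq_mul_laplaceThree_eq hβ0]
  calc ∫⁻ a, ENNReal.ofReal coneConst * (ENNReal.ofReal coneConst * innerK β⁻¹ a) ∂coneMeasure
      ≤ ∫⁻ a, ENNReal.ofReal coneConst * (ENNReal.ofReal coneConst * innerK 0 a) +
          ENNReal.ofReal (β⁻¹ ^ (1/48 : ℝ)) * (ENNReal.ofReal coneConst * (ENNReal.ofReal coneConst * rateE a)) ∂coneMeasure := by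
        refine lintegral_mono_ae ?_
        filter_upwards [ae_goodHub] with a ha
        have h := lintegral_hsc_le_add hs0 hs1 ha.1 ha.2.1
        calc ENNReal.ofReal coneConst * (ENNReal.ofReal coneConst * innerK β⁻¹ a)
            ≤ ENNReal.ofReal coneConst * (ENNReal.ofReal coneConst * (innerK 0 a + ENNReal.ofReal (β⁻¹ ^ (1/48 : ℝ)) * rateE a)) :=
              mul_le_mul' le_rfl (mul_le_mul' le_rfl h)
          _ = _ := by ring
    _ = laplaceThreeLimENN + ENNReal.ofReal (β⁻¹ ^ (1/48 : ℝ)) * rateM := by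
        rw [lintegral_add_right _ ((measurable_rateE.const_mul _).const_mul _ |>.const_mul _), lintegral_const_mul _
          ((measurable_rateE.const_mul _).const_mul _), lintegral_const_mul _ (measurable_rateE.const_mul _),
          lintegral_const_mul _ measurable_rateE]
        rfl

/-- ★★ **LOWER INTEGRAL BOUND**: `v₃ ≤ β²Λ₃(β) + β^{−1/48}·M` for `β ≥ 1` (in `ℝ≥0∞`). [folklore] -/
theorem laplaceThreeLimENN_le {β : ℝ} (hβ : 1 ≤ β) :
    laplaceThreeLimENN ≤ ENNReal.ofReal (β ^ 2 * laplaceThree β) + ENNReal.ofReal (β⁻¹ ^ (1/48 : ℝ)) * rateM := by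
  have hβ0 : 0 < β := by linarith
  have hs0 : 0 < β⁻¹ := inv_pos.2 hβ0
  have hs1 : β⁻¹ ≤ 1 := inv_le_one_of_one_le₀ hβ
  have hint : ∫⁻ a, ENNReal.ofReal (β ^ 2) * psiCone β a ∂coneMeasure = ENNReal.ofReal (β ^ 2 * laplaceThree β) := by
    rw [lintegral_const_mul _ (measurable_psiCone β), ← ofReal_laplaceThree_eq_lintegral_psiCone hβ0.le, ← ENNReal.ofReal_mul (sq_nonneg β)]
  unfold laplaceThreeLimENN
  calc ∫⁻ a, ENNReal.ofReal coneConst * (ENNReal.ofReal coneConst * innerK 0 a) ∂coneMeasure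
      ≤ ∫⁻ a, ENNReal.ofReal (β ^ 2) * psiCone β a +
          ENNReal.ofReal (β⁻¹ ^ (1/48 : ℝ)) * (ENNReal.ofReal coneConst * (ENNReal.ofReal coneConst * rateE a)) ∂coneMeasure := by
        refine lintegral_mono_ae ?_
        filter_upwards [ae_goodHub] with a ha
        have h := lintegral_hsc_zero_le_add hs0 hs1 ha.1 ha.2.1
        have hFK : ENNReal.ofReal (β ^ 2) * psiCone β a = ENNReal.ofReal coneConst * (ENNReal.ofReal coneConst * innerK β⁻¹ a) := by
          unfold innerK
          rw [psiCone_eq_axis β ha.2.2, sq_mul_psiCone_eq_lintegral_hsc hβ0 (axisPoint a) (axisPoint_components a).2.2.1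
            (axisPoint_components a).2.2.2, lintegral_lintegral_hsc_eq]
        rw [hFK]
        calc ENNReal.ofReal coneConst * (ENNReal.ofReal coneConst * innerK 0 a)
            ≤ ENNReal.ofReal coneConst * (ENNReal.ofReal coneConst * (innerK β⁻¹ a + ENNReal.ofReal (β⁻¹ ^ (1/48 : ℝ)) * rateE a)) :=
              mul_le_mul' le_rfl (mul_le_mul' le_rfl h)
          _ = _ := by ring
    _ = ENNReal.ofReal (β ^ 2 * laplaceThree β) + ENNReal.ofReal (β⁻¹ ^ (1/48 : ℝ)) * rateM := by
        rw [lintegral_add_right _ ((measurable_rateE.const_mul _).const_mul _ |>.const_mul _), lintegral_const_mul _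
          ((measurable_rateE.const_mul _).const_mul _), lintegral_const_mul _ (measurable_rateE.const_mul _),
          lintegral_const_mul _ measurable_rateE, hint]
        rfl

/-- `v₃ < ∞` (from the lower bound at `β = 1`). [folklore] -/
theorem laplaceThreeLimENN_lt_top : laplaceThreeLimENN < ∞ := by
  refine lt_of_le_of_lt (laplaceThreeLimENN_le le_rfl) ?_
  exact ENNReal.add_lt_top.2 ⟨ENNReal.ofReal_lt_top, ENNReal.mul_lt_top ENNReal.ofReal_lt_top rateM_lt_top⟩

/-! ## §2 The rate -/

/-- `(β⁻¹)^{θ} = β^{−θ}` for `β > 0`. [folklore] -/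
theorem inv_rpow_eq_rpow_neg {β θ : ℝ} (hβ : 0 < β) : β⁻¹ ^ θ = β ^ (-θ) := by
  rw [Real.inv_rpow hβ.le, Real.rpow_neg hβ.le]

/-- ★★★ **THE POWER RATE**: `|β²Λ₃(β) − v₃| ≤ K·β^{−1/48}` for every `β ≥ 1`, with `K = (coneConst²·∫E dcone).toReal`
(`E(a) = rateCst·(‖Im a‖²)^{−35/24}`).  HONEST LABEL: plan-level zero-mode rung; NOT ⟨24197⟩; the Yang–Mills mass gap is NOT proved.
[cite: GonzalezarroyoAltes1988] [cite: Vanbaal2001] -/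
theorem abs_sq_mul_laplaceThree_sub_limit_le {β : ℝ} (hβ : 1 ≤ β) :
    |β ^ 2 * laplaceThree β - laplaceThreeLimit| ≤ rateM.toReal * β ^ (-(1/48 : ℝ)) := by
  have hβ0 : 0 < β := by linarith
  have hLtop : laplaceThreeLimENN ≠ ∞ := laplaceThreeLimENN_lt_top.ne
  have hMtop : rateM ≠ ∞ := rateM_lt_top.ne
  have hEtop : ENNReal.ofReal (β⁻¹ ^ (1/48 : ℝ)) * rateM ≠ ∞ := ENNReal.mul_ne_top ENNReal.ofReal_ne_top hMtop
  have hE : (ENNReal.ofReal (β⁻¹ ^ (1/48 : ℝ)) * rateM).toReal = rateM.toReal * β ^ (-(1/48 : ℝ)) := by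
    rw [ENNReal.toReal_mul, ENNReal.toReal_ofReal (Real.rpow_nonneg (inv_pos.2 hβ0).le _), inv_rpow_eq_rpow_neg hβ0, mul_comm]
  have hnn : 0 ≤ β ^ 2 * laplaceThree β := mul_nonneg (sq_nonneg β) (laplaceThree_nonneg β)
  have hU := ofReal_sq_mul_laplaceThree_le hβ
  have hL := laplaceThreeLimENN_le hβ
  rw [abs_le]
  constructor
  · -- from the lower bound
    have h1 : laplaceThreeLimENN.toReal ≤ (ENNReal.ofReal (β ^ 2 * laplaceThree β) + ENNReal.ofReal (β⁻¹ ^ (1/48 : ℝ)) * rateM).toReal :=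
      ENNReal.toReal_mono (ENNReal.add_ne_top.2 ⟨ENNReal.ofReal_ne_top, hEtop⟩) hL
    rw [ENNReal.toReal_add ENNReal.ofReal_ne_top hEtop, ENNReal.toReal_ofReal hnn, hE] at h1
    unfold laplaceThreeLimit; linarith
  · have h1 : (ENNReal.ofReal (β ^ 2 * laplaceThree β)).toReal ≤ (laplaceThreeLimENN + ENNReal.ofReal (β⁻¹ ^ (1/48 : ℝ)) * rateM).toReal :=
      ENNReal.toReal_mono (ENNReal.add_ne_top.2 ⟨hLtop, hEtop⟩) hU
    rw [ENNReal.toReal_add hLtop hEtop, ENNReal.toReal_ofReal hnn, hE] at h1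
    unfold laplaceThreeLimit; linarith

/-- ★★ `β²Λ₃(β) → v₃` — so `laplaceThreeLimit` IS the (unique) limit of ✓`tendsto_sq_mul_laplaceThree`. [folklore] -/
theorem tendsto_sq_mul_laplaceThree_limit : Tendsto (fun β : ℝ => β ^ 2 * laplaceThree β) atTop (𝓝 laplaceThreeLimit) := by
  rw [tendsto_iff_dist_tendsto_zero]
  have hK : Tendsto (fun β : ℝ => rateM.toReal * β ^ (-(1/48 : ℝ))) atTop (𝓝 0) := by
    have h := (tendsto_rpow_neg_atTop (by norm_num : (0:ℝ) < 1/48)).const_mul rateM.toReal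
    rwa [mul_zero] at h
  refine squeeze_zero' (Eventually.of_forall fun β => dist_nonneg) ?_ hK
  filter_upwards [eventually_ge_atTop (1:ℝ)] with β hβ
  rw [Real.dist_eq]
  exact abs_sq_mul_laplaceThree_sub_limit_le hβ

/-- ★★ `v₃ > 0` (by uniqueness of limits and w2 g55's ✓`tendsto_sq_mul_laplaceThree`). [folklore] -/
theorem laplaceThreeLimit_pos : 0 < laplaceThreeLimit := by
  obtain ⟨v, hv, hT⟩ := tendsto_sq_mul_laplaceThree
  rw [tendsto_nhds_unique tendsto_sq_mul_laplaceThree_limit hT]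
  exact hv

/-! ## §3 The headline -/

/-- ★★★ **THE EXACT THREE-LETTER ZERO-MODE RUNG ON THE GROUP, LAPLACE FORM, WITH A POWER RATE**:
`∃ v K θ, 0 < v ∧ 0 < θ ∧ ∀ β ≥ 1, |β²·∫_{SU(2)³} e^{−β(‖[q₀,q₁]‖² + ‖[q₀,q₂]‖² + ‖[q₁,q₂]‖²)} dHaar³ − v| ≤ K·β^{−θ}` (θ = 1/48, not optimised).
HONEST LABEL: plan-level zero-mode rung of a DRAFT line «sharp-sigma» (the Laplace currency of ✓`SharpSigma.swapGluedStiffness_of_sharpSwapLaplace`);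
NOT the fixed-`L` sharp law, NOT ⟨24197⟩; the Yang–Mills mass gap is NOT proved; no summit is proved by a line.
[cite: GonzalezarroyoAltes1988] [cite: Vanbaal2001] -/
theorem laplaceThree_sharp :
    ∃ v K θ : ℝ, 0 < v ∧ 0 < θ ∧ ∀ β : ℝ, 1 ≤ β → |β ^ 2 * laplaceThree β - v| ≤ K * β ^ (-θ) :=
  ⟨laplaceThreeLimit, rateM.toReal, 1/48, laplaceThreeLimit_pos, by norm_num, fun _ hβ => abs_sq_mul_laplaceThree_sub_limit_le hβ⟩

/-! ## §4 (appended) The relative shape `β²Λ₃(β) = v₃(1 + O(β^{−θ}))` -/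

/-- ★★★ **RELATIVE FORM** (LEAD g93's 07:46Z shape «`v(1 + O(β^{−θ}))`» verbatim for the Laplace block):
`|β²Λ₃(β)/v₃ − 1| ≤ (K/v₃)·β^{−1/48}` for `β ≥ 1`.  HONEST LABEL: plan-level zero-mode rung; NOT ⟨24197⟩; the Yang–Mills mass gap is NOT proved.
[cite: GonzalezarroyoAltes1988] [cite: Vanbaal2001] -/
theorem abs_sq_mul_laplaceThree_div_sub_one_le {β : ℝ} (hβ : 1 ≤ β) :
    |β ^ 2 * laplaceThree β / laplaceThreeLimit - 1| ≤ rateM.toReal / laplaceThreeLimit * β ^ (-(1/48 : ℝ)) := by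
  have hv := laplaceThreeLimit_pos
  have h := abs_sq_mul_laplaceThree_sub_limit_le hβ
  have e : β ^ 2 * laplaceThree β / laplaceThreeLimit - 1 = (β ^ 2 * laplaceThree β - laplaceThreeLimit) / laplaceThreeLimit := by
    field_simp
  rw [e, abs_div, abs_of_pos hv, div_le_iff₀ hv]
  calc |β ^ 2 * laplaceThree β - laplaceThreeLimit| ≤ rateM.toReal * β ^ (-(1/48 : ℝ)) := h
    _ = rateM.toReal / laplaceThreeLimit * β ^ (-(1/48 : ℝ)) * laplaceThreeLimit := by field_simp

/-- ★★★ **THE RELATIVE HEADLINE**: `∃ v κ θ, 0 < v ∧ 0 < θ ∧ ∀ β ≥ 1, |β²Λ₃(β)/(v) − 1| ≤ κ·β^{−θ}`. [cite: GonzalezarroyoAltes1988] [cite: Vanbaal2001] -/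
theorem laplaceThree_relative :
    ∃ v κ θ : ℝ, 0 < v ∧ 0 < θ ∧ ∀ β : ℝ, 1 ≤ β → |β ^ 2 * laplaceThree β / v - 1| ≤ κ * β ^ (-θ) :=
  ⟨laplaceThreeLimit, rateM.toReal / laplaceThreeLimit, 1/48, laplaceThreeLimit_pos, by norm_num,
    fun _ hβ => abs_sq_mul_laplaceThree_div_sub_one_le hβ⟩

end Summit.QuantumFields.YangMills.Theorems.SwapVirialDeficit.ZeroModeGroup

end
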